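import Literature.NumberTheory.Automorphic.HilbertRepOccurrence
import Literature.NumberTheory.Automorphic.AutomorphicSpectrum
import Literature.NumberTheory.Automorphic.AutomorphicForms
import HarnessLib

/-!
# Archimedean type, `K_∞`-type subspaces and level of automorphic representations in
# `L²(G(F)\G(𝔸))`
(Borel–Jacquet, *Automorphic forms and automorphic representations*, Corvallis (1979), §4.6;
Borel–Wallach, *Continuous cohomology, discrete subgroups, and representations of reductive
groups*, 2nd ed. (2000), VII §3, XIII–XIV; Deitmar–Echterhoff, *Principles of Harmonic Analysis*
(2014), §7.3, §7.5)

Topic `NumberTheory/Automorphic`; definitions and theorems, no named fact, no instance, over the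
tree's CONCRETE carriers: an adelic group datum `𝒢` (`AdelicGroupData`), an automorphy datum
`𝒟 : AutomorphyDatum 𝒢 A N` (`G_∞ = 𝒟.arch`, `K_∞ = 𝒟.arch.maximalCompact`,
`G(𝔸_f) = 𝒟.finiteAdelic`, `ofArch : G_∞ →* G(𝔸)` commuting with `G(𝔸_f)`), an invariant measure
`μ` on the automorphic quotient and the regular representation `R = 𝒢.rightRegular μ` on
`L² = L²(G(𝔸) ⧸ A_G G(F), μ)` (`AutomorphicSpectrum`).

This is what "the automorphic representation `π ⊂ L²` has archimedean component `π_∞ ≅ τ`",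
"the `K_∞`-isotypic subspace `L²[κ]` and its projector `pr_κ`, which commutes with `R(G(𝔸_f))`"
and "`π` occurs at level `K_f` (`π^{K_f} ≠ 0`)" mean concretely on `L²`, i.e. the index set and
the summands of the right-hand side `⊕_{π : π_∞ ≅ τ} m(π) π_f^{K_f}` of Matsushima-type formulas
for `H^•(S(K_f))` (Borel–Wallach VII 3.2, XIV; the formula itself is NOT stated here):

* `𝒟.archRegular μ`, `𝒟.kRegular μ`, `𝒟.finiteRegular μ` — `R|_{G_∞}`, `R|_{K_∞}`, `R|_{G(𝔸_f)}`
  (Mathlib `ContRepresentation.restrict`); all unitary.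
* `𝒟.archTypeClass μ τ : Set (ClosedSubrep R)` — **`𝒜(τ)`**, the irreducible closed
  subrepresentations `π ⊂ L²` whose restriction to `G_∞` is purely `τ`-isotypic
  (`ContRepresentation.pureTypeClass` of `HilbertRepOccurrence`), for a PARAMETER
  `τ : ContRepresentation ℂ G_∞ Hτ` (e.g. `τ = J ⊠ 1` on `U(2,1) × U(3)^{d-1}`; nothing about any
  particular `τ` is claimed here); `𝒟.archTypeClassAtLevel μ τ Kf` — those with `π^{Kf} ≠ 0`
  (tree `ClosedSubrep.fixedVectors`); `archTypeClassAtLevel_anti` (smaller level, more `π`),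
  `mem_archTypeClassAtLevel_iff_occursInAtLevel` (link with `OccursInAtLevel`).
* `𝒟.kTypeSpace μ κ` — **`L²[κ]`**, the `κ`-isotypic component of `R|_{K_∞}` for a PARAMETER
  `κ : ContRepresentation ℂ K_∞ Hκ` (e.g. `κ = 𝔭₊^∨`), and `𝒟.kTypeProjection μ κ = pr_κ`, the
  orthogonal projection onto it; **`rightRegular_apply_mem_kTypeSpace`** (`L²[κ]` is
  `R(G(𝔸_f))`-stable, from `𝒟.commute_ofArch` and `apply_mem_isotypicComponent_of_commute`) and
  **`kTypeProjection_rightRegular_comm`** (`pr_κ ∘ R(h) = R(h) ∘ pr_κ` for `h ∈ G(𝔸_f)`,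
  `IsUnitary.starProjection_map_eq`); `kTypeProjection_apply_eq_self_iff` (range).
* for a discrete automorphic representation `P : DiscreteAutomorphicRep 𝒢 μ`
  (`AutomorphicSpectrum`): `P.HasArchType 𝒟 τ`, `P.HasLevel Kf` (`P^{Kf} ≠ 0`),
  `P.mem_archTypeClassAtLevel_iff`, `P.hasLevel_iff_occursInAtLevel`.

## Mathlib / tree

Mathlib: `ContRepresentation.restrict` (`restrict_apply`), `Submodule.starProjection`
(`starProjection_eq_self_iff`). Tree: `AdelicGroupData.rightRegular`, `isUnitary_rightRegular`,
`DiscreteAutomorphicRep`, `ClosedSubrep.fixedVectors` (`AutomorphicSpectrum`); `AutomorphyDatum`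
with `ofArch`, `ofK`, `finiteAdelic`, `commute_ofArch` (`AutomorphicForms`); `isotypicComponent`,
`apply_mem_isotypicComponent_of_commute` (`HilbertRepIsotypicComponent`);
`IsUnitary.starProjection_map_eq` (`UnitaryIsotypicProjection`); `pureTypeClass`, `HasPureType`,
`OccursInAtLevel`, `occursInAtLevel_iff` (`HilbertRepOccurrence`). Nothing is duplicated.

## Design notes

* Deliberate dot-notation extensions of the tree structures `AutomorphyDatum` (`𝒟.archRegular`,
  …, `𝒟.kTypeProjection`) and `DiscreteAutomorphicRep` (`P.HasArchType`, `P.HasLevel`), inside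
  `namespace Literature.NumberTheory.Automorphic` like the files they continue.
* `τ`, `κ` are PARAMETERS (representations of `G_∞`, `K_∞` on Hilbert spaces): the file types the
  predicates, it does not single out or construct any representation of a real group.
* Only the bare invariance `[SMulInvariantMeasure]` of `μ` is assumed (what `rightRegular` needs);
  no strong continuity, no discreteness of the spectrum.
* Provenance. Concrete layer written for the model-construction sub-cell of the adjudication of
  the 2001 Hodge/CM manuscripts (their `𝒜^{1,0}`, `π[τ]`, `pr`, "`m(π) π_f^{K_f}`" are instances);
  nothing here is a claim of those manuscripts.

## References

* A. Borel, H. Jacquet, *Automorphic forms and automorphic representations*, Proc. Sympos. Pure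
  Math. 33.1 (1979), §4.6 [BorelJacquet1979].
* A. Borel, N. Wallach, *Continuous cohomology, discrete subgroups, and representations of
  reductive groups*, 2nd ed., AMS (2000), VII §3 (Thm. 3.2), XIII §1, XIV [BorelWallach2000].
* A. Deitmar, S. Echterhoff, *Principles of Harmonic Analysis*, 2nd ed. (2014), §7.3, §7.5
  [DeitmarEchterhoff2014].
-/

noncomputable section

open MeasureTheory Topology ContRepresentation
open scoped InnerProductSpace

universe u

namespace Literature.NumberTheory.Automorphic

variable {K : Type} [Field K] [NumberField K] {𝒢 : AdelicGroupData.{u} K}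
  {A : Type*} [NormedCommRing A] [NormedAlgebra ℝ A] [NormedAlgebra ℚ A] [CompleteSpace A]
  [StarRing A] {N : Type*} [Fintype N] [DecidableEq N]
  (𝒟 : AutomorphyDatum 𝒢 A N) (μ : Measure 𝒢.automorphicQuotient)
  [SMulInvariantMeasure 𝒢.Adelic 𝒢.automorphicQuotient μ]

namespace AutomorphyDatum

/-! ### The restrictions of the regular representation to `G_∞`, `K_∞`, `G(𝔸_f)` -/

/-- `R|_{G_∞}`: the regular representation of `L²(G(𝔸) ⧸ A_G G(F))` restricted along
`ofArch : G_∞ →* G(𝔸)` (Borel–Jacquet (1979), §4.6). [cite: BorelJacquet1979, §4.6] -/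
def archRegular : ContRepresentation ℂ 𝒟.arch.carrier (𝒢.L2 μ) :=
  (𝒢.rightRegular μ).restrict 𝒟.ofArch

/-- `R|_{K_∞}`: the regular representation restricted along `ofK : K_∞ →* G(𝔸)`
(Borel–Jacquet (1979), §4.6). [cite: BorelJacquet1979, §4.6] -/
def kRegular : ContRepresentation ℂ 𝒟.arch.maximalCompact (𝒢.L2 μ) :=
  (𝒢.rightRegular μ).restrict 𝒟.ofK

/-- `R|_{G(𝔸_f)}`: the regular representation restricted to the finite-adelic points
(Borel–Jacquet (1979), §4.6). [cite: BorelJacquet1979, §4.6] -/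
def finiteRegular : ContRepresentation ℂ 𝒟.finiteAdelic (𝒢.L2 μ) :=
  (𝒢.rightRegular μ).restrict 𝒟.finiteAdelic.subtype

/-- Unfolding `R|_{G_∞}`. [folklore] -/
@[simp]
theorem archRegular_apply (g : 𝒟.arch.carrier) :
    𝒟.archRegular μ g = 𝒢.rightRegular μ (𝒟.ofArch g) := rfl

/-- Unfolding `R|_{K_∞}`. [folklore] -/
@[simp]
theorem kRegular_apply (k : 𝒟.arch.maximalCompact) :
    𝒟.kRegular μ k = 𝒢.rightRegular μ (𝒟.ofK k) := rfl

/-- Unfolding `R|_{G(𝔸_f)}`. [folklore] -/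
@[simp]
theorem finiteRegular_apply (h : 𝒟.finiteAdelic) :
    𝒟.finiteRegular μ h = 𝒢.rightRegular μ (h : 𝒢.Adelic) := rfl

/-- `R|_{G_∞}` is unitary. [folklore] -/
theorem isUnitary_archRegular : (𝒟.archRegular μ).IsUnitary :=
  fun g => 𝒢.isUnitary_rightRegular μ (𝒟.ofArch g)

/-- `R|_{K_∞}` is unitary. [folklore] -/
theorem isUnitary_kRegular : (𝒟.kRegular μ).IsUnitary :=
  fun k => 𝒢.isUnitary_rightRegular μ (𝒟.ofK k)

/-- `R|_{G(𝔸_f)}` is unitary. [folklore] -/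
theorem isUnitary_finiteRegular : (𝒟.finiteRegular μ).IsUnitary :=
  fun h => 𝒢.isUnitary_rightRegular μ (h : 𝒢.Adelic)

/-- `R(ofArch g)` and `R(h)` commute for `h ∈ G(𝔸_f)` (`𝒟.commute_ofArch`). [cite: BorelJacquet1979, §4.1–4.2] -/
theorem rightRegular_ofArch_comm (g : 𝒟.arch.carrier) {h : 𝒢.Adelic} (hh : h ∈ 𝒟.finiteAdelic) :
    𝒢.rightRegular μ h ∘L 𝒢.rightRegular μ (𝒟.ofArch g) =
      𝒢.rightRegular μ (𝒟.ofArch g) ∘L 𝒢.rightRegular μ h := by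
  rw [← ContinuousLinearMap.mul_def, ← ContinuousLinearMap.mul_def, ← map_mul, ← map_mul,
    𝒟.commute_ofArch g h hh]

/-! ### Archimedean type: the classes `𝒜(τ)` and `𝒜(τ; K_f)` -/

variable {Hτ : Type*} [NormedAddCommGroup Hτ] [InnerProductSpace ℂ Hτ]

/-- **`𝒜(τ)`**: the irreducible closed subrepresentations `π ⊂ L²(G(𝔸) ⧸ A_G G(F))` whose
restriction to `G_∞` is purely `τ`-isotypic ("`π_∞ ≅ τ`"), for an archimedean type
`τ : ContRepresentation ℂ G_∞ Hτ` (Borel–Wallach (2000), VII §3, XIV; Borel–Jacquet (1979),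
§4.6). [cite: BorelWallach2000, VII §3] -/
def archTypeClass (τ : ContRepresentation ℂ 𝒟.arch.carrier Hτ) :
    Set (ClosedSubrep (𝒢.rightRegular μ)) :=
  (𝒢.rightRegular μ).pureTypeClass 𝒟.ofArch τ

/-- **`𝒜(τ; K_f)`**: the members of `𝒜(τ)` with a non-zero `K_f`-fixed vector, `π^{K_f} ≠ 0` —
the index set of the sum `⊕_{π_∞ ≅ τ} m(π) π_f^{K_f}` (Borel–Wallach (2000), VII §3, XIV;
Borel–Jacquet (1979), §4.6). [cite: BorelWallach2000, VII §3] -/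
def archTypeClassAtLevel (τ : ContRepresentation ℂ 𝒟.arch.carrier Hτ) (Kf : Subgroup 𝒢.Adelic) :
    Set (ClosedSubrep (𝒢.rightRegular μ)) :=
  {W | W ∈ 𝒟.archTypeClass μ τ ∧ W.fixedVectors Kf ≠ ⊥}

variable {𝒟 μ} {τ : ContRepresentation ℂ 𝒟.arch.carrier Hτ}

/-- Unfolding membership in `𝒜(τ)`. [folklore] -/
theorem mem_archTypeClass_iff {W : ClosedSubrep (𝒢.rightRegular μ)} :
    W ∈ 𝒟.archTypeClass μ τ ↔
      W.toContRep.IsTopIrreducible ∧ W.toContRep.HasPureType 𝒟.ofArch τ :=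
  Iff.rfl

/-- Unfolding membership in `𝒜(τ; K_f)`. [folklore] -/
theorem mem_archTypeClassAtLevel_iff {W : ClosedSubrep (𝒢.rightRegular μ)} {Kf : Subgroup 𝒢.Adelic} :
    W ∈ 𝒟.archTypeClassAtLevel μ τ Kf ↔ W ∈ 𝒟.archTypeClass μ τ ∧ W.fixedVectors Kf ≠ ⊥ :=
  Iff.rfl

/-- `𝒜(τ; K_f) ⊆ 𝒜(τ)`. [folklore] -/
theorem archTypeClassAtLevel_subset (Kf : Subgroup 𝒢.Adelic) :
    𝒟.archTypeClassAtLevel μ τ Kf ⊆ 𝒟.archTypeClass μ τ :=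
  fun _ h => h.1

/-- `𝒜(τ)` depends on `τ` only up to unitary equivalence. [folklore] -/
theorem archTypeClass_congr {Hτ' : Type*} [NormedAddCommGroup Hτ'] [InnerProductSpace ℂ Hτ']
    {τ' : ContRepresentation ℂ 𝒟.arch.carrier Hτ'} (h : AreUnitarilyEquivalent τ τ') :
    𝒟.archTypeClass μ τ = 𝒟.archTypeClass μ τ' :=
  pureTypeClass_congr h

/-- `K_f ↦ 𝒜(τ; K_f)` is antitone: a smaller level sees more representations. [folklore] -/
theorem archTypeClassAtLevel_anti {Kf Kf' : Subgroup 𝒢.Adelic} (hKK' : Kf ≤ Kf') :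
    𝒟.archTypeClassAtLevel μ τ Kf' ⊆ 𝒟.archTypeClassAtLevel μ τ Kf := by
  rintro W ⟨hW, hfix⟩
  refine ⟨hW, fun hbot => hfix ?_⟩
  exact le_bot_iff.mp ((W.fixedVectors_antitone hKK').trans hbot.le)

/-- A closed subrepresentation `W` has a non-zero `K_f`-fixed vector iff (as a member of its own
class) it occurs at level `K_f` in the sense of `OccursInAtLevel`. [folklore] -/
theorem fixedVectors_ne_bot_iff_occursInAtLevel {W : ClosedSubrep (𝒢.rightRegular μ)}
    (hW : W.toContRep.IsTopIrreducible) (Kf : Subgroup 𝒢.Adelic) :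
    W.fixedVectors Kf ≠ ⊥ ↔ (𝒢.rightRegular μ).OccursInAtLevel W.toContRep Kf := by
  rw [occursInAtLevel_iff]
  exact ⟨fun h => ⟨⟨W, hW, AreUnitarilyEquivalent.refl _⟩, h⟩, fun h => h.2⟩

/-- **`π ∈ 𝒜(τ; K_f)` iff `π ∈ 𝒜(τ)` and `π` occurs in `L²` at level `K_f`.** [cite: BorelJacquet1979, §4.6] -/
theorem mem_archTypeClassAtLevel_iff_occursInAtLevel {W : ClosedSubrep (𝒢.rightRegular μ)}
    {Kf : Subgroup 𝒢.Adelic} :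
    W ∈ 𝒟.archTypeClassAtLevel μ τ Kf ↔
      W ∈ 𝒟.archTypeClass μ τ ∧ (𝒢.rightRegular μ).OccursInAtLevel W.toContRep Kf := by
  constructor
  · rintro ⟨hW, hfix⟩
    exact ⟨hW, (fixedVectors_ne_bot_iff_occursInAtLevel hW.1 Kf).mp hfix⟩
  · rintro ⟨hW, hocc⟩
    exact ⟨hW, (fixedVectors_ne_bot_iff_occursInAtLevel hW.1 Kf).mpr hocc⟩

/-! ### `K_∞`-types: the isotypic subspace `L²[κ]` and its projector `pr_κ` -/

variable (𝒟 μ)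
variable {Hκ : Type*} [NormedAddCommGroup Hκ] [InnerProductSpace ℂ Hκ]

/-- **`L²[κ]`**: the `κ`-isotypic component of `R|_{K_∞}`, for a `K_∞`-type
`κ : ContRepresentation ℂ K_∞ Hκ` (Borel–Jacquet (1979), §4.6, `K`-types; Deitmar–Echterhoff
(2014), §7.3). [cite: DeitmarEchterhoff2014, §7.3] -/
def kTypeSpace (κ : ContRepresentation ℂ 𝒟.arch.maximalCompact Hκ) :
    ClosedSubrep (𝒟.kRegular μ) :=
  (𝒟.kRegular μ).isotypicComponent κ

/-- **`pr_κ`**: the orthogonal projection of `L²` onto `L²[κ]` (Deitmar–Echterhoff (2014),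
Prop. 7.3.3). [cite: DeitmarEchterhoff2014, Prop. 7.3.3] -/
def kTypeProjection (κ : ContRepresentation ℂ 𝒟.arch.maximalCompact Hκ) :
    𝒢.L2 μ →L[ℂ] 𝒢.L2 μ :=
  (𝒟.kTypeSpace μ κ).toSubmodule.starProjection

variable {𝒟 μ} {κ : ContRepresentation ℂ 𝒟.arch.maximalCompact Hκ}

/-- `pr_κ v = v` iff `v ∈ L²[κ]` (Mathlib `Submodule.starProjection_eq_self_iff`). [folklore] -/
theorem kTypeProjection_apply_eq_self_iff {v : 𝒢.L2 μ} :
    𝒟.kTypeProjection μ κ v = v ↔ v ∈ 𝒟.kTypeSpace μ κ :=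
  Submodule.starProjection_eq_self_iff

/-- `pr_κ v ∈ L²[κ]`. [folklore] -/
theorem kTypeProjection_apply_mem (v : 𝒢.L2 μ) : 𝒟.kTypeProjection μ κ v ∈ 𝒟.kTypeSpace μ κ :=
  (𝒟.kTypeSpace μ κ).toSubmodule.starProjection_apply_mem v

/-- `R(ofK k)` and `R(h)` commute for `h ∈ G(𝔸_f)`. [cite: BorelJacquet1979, §4.1–4.2] -/
theorem rightRegular_ofK_comm (k : 𝒟.arch.maximalCompact) {h : 𝒢.Adelic} (hh : h ∈ 𝒟.finiteAdelic) :
    𝒢.rightRegular μ h ∘L 𝒟.kRegular μ k = 𝒟.kRegular μ k ∘L 𝒢.rightRegular μ h := by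
  rw [kRegular_apply, AutomorphyDatum.ofK_apply]
  exact rightRegular_ofArch_comm 𝒟 μ _ hh

/-- **`L²[κ]` is stable under `R(G(𝔸_f))`**: `R(h)` commutes with `R|_{K_∞}` for `h ∈ G(𝔸_f)`
(`commute_ofArch`), and an operator commuting with a unitary representation preserves its isotypic
components (`apply_mem_isotypicComponent_of_commute`; Deitmar–Echterhoff (2014), §7.3).
[cite: DeitmarEchterhoff2014, §7.3] -/
theorem rightRegular_apply_mem_kTypeSpace {h : 𝒢.Adelic} (hh : h ∈ 𝒟.finiteAdelic) {v : 𝒢.L2 μ}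
    (hv : v ∈ 𝒟.kTypeSpace μ κ) : 𝒢.rightRegular μ h v ∈ 𝒟.kTypeSpace μ κ :=
  apply_mem_isotypicComponent_of_commute (isUnitary_kRegular 𝒟 μ)
    (fun k => rightRegular_ofK_comm k hh) hv

/-- **`pr_κ` commutes with `R(G(𝔸_f))`**: `pr_κ (R(h) v) = R(h) (pr_κ v)` for `h ∈ G(𝔸_f)`
(`L²[κ]` is a closed `R(G(𝔸_f))`-stable subspace and `R|_{G(𝔸_f)}` is unitary:
`IsUnitary.starProjection_map_eq`; Deitmar–Echterhoff (2014), Prop. 7.3.3).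
[cite: DeitmarEchterhoff2014, Prop. 7.3.3] -/
theorem kTypeProjection_rightRegular_apply {h : 𝒢.Adelic} (hh : h ∈ 𝒟.finiteAdelic) (v : 𝒢.L2 μ) :
    𝒟.kTypeProjection μ κ (𝒢.rightRegular μ h v) =
      𝒢.rightRegular μ h (𝒟.kTypeProjection μ κ v) := by
  have hM : ∀ h' : 𝒟.finiteAdelic, ∀ w ∈ (𝒟.kTypeSpace μ κ).toSubmodule,
      𝒟.finiteRegular μ h' w ∈ (𝒟.kTypeSpace μ κ).toSubmodule :=
    fun h' w hw => rightRegular_apply_mem_kTypeSpace h'.2 hw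
  exact (isUnitary_finiteRegular 𝒟 μ).starProjection_map_eq hM ⟨h, hh⟩ v

/-- `pr_κ ∘ R(h) = R(h) ∘ pr_κ` for `h ∈ G(𝔸_f)`, as an operator identity.
[cite: DeitmarEchterhoff2014, Prop. 7.3.3] -/
theorem kTypeProjection_rightRegular_comm {h : 𝒢.Adelic} (hh : h ∈ 𝒟.finiteAdelic) :
    𝒟.kTypeProjection μ κ ∘L 𝒢.rightRegular μ h = 𝒢.rightRegular μ h ∘L 𝒟.kTypeProjection μ κ :=
  ContinuousLinearMap.ext fun v => kTypeProjection_rightRegular_apply hh v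

/-- `L²[κ]` depends on `κ` only up to unitary equivalence. [folklore] -/
theorem kTypeSpace_congr {Hκ' : Type*} [NormedAddCommGroup Hκ'] [InnerProductSpace ℂ Hκ']
    {κ' : ContRepresentation ℂ 𝒟.arch.maximalCompact Hκ'} (h : AreUnitarilyEquivalent κ κ') :
    𝒟.kTypeSpace μ κ = 𝒟.kTypeSpace μ κ' :=
  isotypicComponent_congr h

end AutomorphyDatum

/-! ### Discrete automorphic representations: archimedean type and level -/

namespace DiscreteAutomorphicRep

variable {𝒟 μ}
variable {Hτ : Type*} [NormedAddCommGroup Hτ] [InnerProductSpace ℂ Hτ]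

/-- `Π` **has archimedean type `τ`**: the restriction of `Π` to `G_∞` is purely `τ`-isotypic
("`Π_∞ ≅ τ`"; Borel–Wallach (2000), VII §3; Borel–Jacquet (1979), §4.6).
[cite: BorelWallach2000, VII §3] -/
def HasArchType (P : DiscreteAutomorphicRep 𝒢 μ) (𝒟 : AutomorphyDatum 𝒢 A N)
    (τ : ContRepresentation ℂ 𝒟.arch.carrier Hτ) : Prop :=
  P.space.toContRep.HasPureType 𝒟.ofArch τ

/-- `Π` **has level `K_f`**: `Π^{K_f} ≠ 0` (Borel–Jacquet (1979), §4.6). [cite: BorelJacquet1979, §4.6] -/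
def HasLevel (P : DiscreteAutomorphicRep 𝒢 μ) (Kf : Subgroup 𝒢.Adelic) : Prop :=
  P.space.fixedVectors Kf ≠ ⊥

variable {τ : ContRepresentation ℂ 𝒟.arch.carrier Hτ}

/-- `Π ∈ 𝒜(τ)` iff `Π` has archimedean type `τ` (irreducibility is part of `Π`). [folklore] -/
theorem space_mem_archTypeClass_iff (P : DiscreteAutomorphicRep 𝒢 μ) :
    P.space ∈ 𝒟.archTypeClass μ τ ↔ P.HasArchType 𝒟 τ :=
  ⟨fun h => h.2, fun h => ⟨P.irreducible, h⟩⟩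

/-- `Π ∈ 𝒜(τ; K_f)` iff `Π` has archimedean type `τ` and level `K_f`. [folklore] -/
theorem space_mem_archTypeClassAtLevel_iff (P : DiscreteAutomorphicRep 𝒢 μ) (Kf : Subgroup 𝒢.Adelic) :
    P.space ∈ 𝒟.archTypeClassAtLevel μ τ Kf ↔ P.HasArchType 𝒟 τ ∧ P.HasLevel Kf := by
  rw [AutomorphyDatum.mem_archTypeClassAtLevel_iff, space_mem_archTypeClass_iff]
  rfl

/-- Level is antitone: `K_f ≤ K_f'` and `Π^{K_f'} ≠ 0` give `Π^{K_f} ≠ 0`. [folklore] -/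
theorem HasLevel.anti {P : DiscreteAutomorphicRep 𝒢 μ} {Kf Kf' : Subgroup 𝒢.Adelic}
    (hKK' : Kf ≤ Kf') (h : P.HasLevel Kf') : P.HasLevel Kf :=
  fun hbot => h (le_bot_iff.mp ((P.space.fixedVectors_antitone hKK').trans hbot.le))

/-- `Π` has level `K_f` iff `Π` occurs in `L²` at level `K_f` (`OccursInAtLevel`). [cite: BorelJacquet1979, §4.6] -/
theorem hasLevel_iff_occursInAtLevel (P : DiscreteAutomorphicRep 𝒢 μ) (Kf : Subgroup 𝒢.Adelic) :
    P.HasLevel Kf ↔ (𝒢.rightRegular μ).OccursInAtLevel P.space.toContRep Kf :=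
  AutomorphyDatum.fixedVectors_ne_bot_iff_occursInAtLevel P.irreducible Kf

/-- A discrete automorphic representation occurs in `L²`. [folklore] -/
theorem occursIn (P : DiscreteAutomorphicRep 𝒢 μ) :
    (𝒢.rightRegular μ).OccursIn P.space.toContRep :=
  ⟨P.space, P.irreducible, AreUnitarilyEquivalent.refl _⟩

end DiscreteAutomorphicRep

end Literature.NumberTheory.Automorphic

end
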